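import Summits.BirchSwinnertonDyer.BirchSwinnertonDyer.Theorems.GenusKolyvaginAtTwoGenusPrimitiveSupplyAtTwoPrimeTwistModelSelmer
import HarnessLib

/-!
# Route `GenusKolyvaginAtTwo`, crux #2 `GenusPrimitiveSupplyAtTwo` (stmt-BirchSwinnertonDyer-22136):
# RIGIDITY of the prime-twist Selmer group on the descent-admissible family — THEOREM A(i) in prime-twist currency:
# `Sel_𝔓(A_{χ_d}/ℚ) = Sel_𝔓(A_{χ_{d'}}/ℚ)` AS SUBGROUPS of `H¹(ℚ, E[2])` for all descent-admissible `d, d'`, decided by the `∞`-bit of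
# `Sel₂(W)`; on the odd branch the canonical, `d`-free `R = Sel₂^{rel ∞}(W)` of order `8` with `Sel₂(W) = Sel₂^{str ∞}(W) = {r ∈ R : res_∞ r = 0}`

Width seat `bsd-line-gk2-p5` g15 (cell `bsd-f1-sign2`, SUPPLY lineage of crux 22136), file 41 of the series; sequel of file 40 `…PrimeTwistModelSelmer`
(the dictionary by name, U′, the UP decision) and file 38 `…PrimeTwistLattice`. THEOREMS ONLY (no definition, no named fact, no `sorry`); helper
`--supports stmt-BirchSwinnertonDyer-22136`; no item is closed; BSD is not proved by any of this.

WHAT (`W/ℚ` globally minimal elliptic, `Δ_W > 0`, `d` descent-admissible with character `χ`):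
* §182 `primeTwist_selmerGroup_eq_kummerStrict_of_exists_localization_ne_zero` — DOWN as an EQUALITY with no torsion hypothesis: some
  `Sel₂(W)`-class non-trivial at `∞` ⟹ `Sel_𝔓(A_χ) = Sel₂^{str ∞}(W)`.
* §183 **`primeTwist_selmerGroup_eq_of_descAdmissible`** (`E(ℚ)[2] = 0`) — RIGIDITY: `Sel_𝔓(A_{χ_d}) = Sel_𝔓(A_{χ_{d'}})` inside `H¹(ℚ, E[2])` for all
  descent-admissible `d, d'` (both are `Sel₂^{rel ∞}(W)` if `Sel₂(W)` is strict at `∞`, both `Sel₂^{str ∞}(W)` otherwise) — Theorem A(i) of the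
  `-desc` memo §17 («`R := Sel₂(W^{(d)})` does not depend on `d ∈ 𝒟`») in Mazur–Rubin's formalism, and T-A′ `AdmissibleTwistSelmerLevelAtTwo` as an
  equality of groups rather than of counts; `primeTwist_selmerGroup_eq_relaxed_or_eq_kummerStrict_decided` records WHICH end, by the `∞`-bit.
* §184 the odd branch: `primeTwist_selmerGroup_eq_relaxed_of_onOddBranch` (`Sel_𝔓(A_χ) = Sel₂^{rel ∞}(W)` for EVERY admissible `d`),
  `natCard_selmerGroupRelaxedAtInfinityAtTwo_eq_eight_of_onOddBranch`, `selmerGroup_eq_kummerStrict_of_onOddBranch` (`Sel₂(W)` is the strict group: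
  every `Ш(W)[2]`-class is trivial at `∞`), `forall_localization_eq_zero_of_onOddBranch`.
* §185 (APPEND) `selmerGroup_le_and_relIndex_eq_two_iff_forall_localization_eq_zero` — U′'s conclusion «`Sel₂(W) ≤ Sel_𝔓(A_χ)` of index `2`» OFF
  the odd branch holds IFF the Selmer egg bit is `0`; otherwise the roles swap (`primeTwist_selmerGroup_le_and_relIndex_eq_two_of_exists_localization_ne_zero`).

Honest framing: KNOWN in print (Kramer 1981 Thm. 1 / Prop. 7; Mazur–Rubin 2010 Lemma 3.2 / Prop. 3.3; Morgan 2023 Lemma 16); kernel-new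
bookkeeping; beyond-print theorem: no. Crux 22136 stays OPEN exactly at (U) 24947 ∧ (CONV₂) 19220/24948. BSD is not proved by any of this.

References: [Kramer1981] Thm. 1, Prop. 6, Prop. 7; [MazurRubin2010] Def. 3.1, Lemma 3.2, Prop. 3.3; [Morgan2023KummerGeneric] Lemma 16;
[MazurRubin2007] §3, Def. 4.3.
-/

set_option linter.dupNamespace false -- tree convention: `Summit.BirchSwinnertonDyer.BirchSwinnertonDyer.Theorems` (summit = sub-problem)
set_option autoImplicit false

noncomputable section

open scoped Classical

namespace Summit.BirchSwinnertonDyer.BirchSwinnertonDyer.Theorems.GenusKolyArch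

open WeierstrassCurve Field NumberField
open Literature.NumberTheory.EllipticCurves Literature.NumberTheory.GaloisRepresentations
open Summit.BirchSwinnertonDyer.Rank1Residual.X11b.KummerPT (kummerStrict)
open Summit.BirchSwinnertonDyer.Rank1Residual.F1Sign2

variable (W : WeierstrassCurve ℚ) [W.IsElliptic] [W.IsGloballyMinimal] {d d' : ℤ}
  {χ χ' : absoluteGaloisGroup ℚ →ₜ* Multiplicative (ZMod 2)}

/-! ## §182 DOWN as an equality -/

/-- **Some `Sel₂(W)`-class non-trivial at `∞` ⟹ `Sel_𝔓(A_χ/ℚ) = Sel₂^{str ∞}(W)`** (`Δ_W > 0`, `d` descent-admissible; no torsion or `Ш` hypothesis):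
such a class forces `Sel₂(W) = Sel₂^{rel ∞}(W)` (file 38's dichotomy), and then file 38's «egg bit `1` ⟹ DOWN». [cite: Kramer1981, Prop. 7 and Thm. 1]
[cite: MazurRubin2010, Lemma 3.2 and Prop 3.3] -/
theorem primeTwist_selmerGroup_eq_kummerStrict_of_exists_localization_ne_zero (hΔ : 0 < W.Δ) (hd : DescAdmissible W d)
    (hχ : IsQuadraticCharacterOf χ d) (w : InfinitePlace ℚ)
    (hex : ∃ c ∈ W.selmerGroup ((2 : ℕ) : ℤ), galoisCohomology.localization (W.torsionGaloisModule ((2 : ℕ) : ℤ)) (Sum.inl w) 1 c ≠ 0) :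
    PrimeTwist.selmerGroup W χ = (kummerStrict W 2 {(Sum.inl w : Place ℚ)}).selmerGroup := by
  apply primeTwist_selmerGroup_eq_kummerStrict_of_relaxed_le_selmerGroup W hd hχ w
  rcases selmerGroup_eq_kummerStrict_or_eq_relaxed_of_Δ_pos W hΔ w with h | h
  · exfalso
    obtain ⟨c, hc, hne⟩ := hex
    rw [h] at hc
    exact hne ((mem_selmerGroup_kummerStrict_singleton_inl_iff W w c).mp hc).2
  · exact h.symm.le

/-! ## §183 Rigidity: `Sel_𝔓(A_{χ_d})` does not depend on the descent-admissible `d` -/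

/-- **WHICH END, DECIDED** (`Δ_W > 0`, `E(ℚ)[2] = 0`, `d` descent-admissible): `Sel_𝔓(A_χ/ℚ) = Sel₂^{rel ∞}(W)` if every `Sel₂(W)`-class is trivial at `∞`
(file 40 §180, the UP decision), and `Sel_𝔓(A_χ/ℚ) = Sel₂^{str ∞}(W)` otherwise (§182). [cite: Kramer1981, Thm. 1 and Prop. 7] [cite: MazurRubin2010, Prop 3.3] -/
theorem primeTwist_selmerGroup_eq_relaxed_or_eq_kummerStrict_decided (hΔ : 0 < W.Δ) (hT : NoRationalTwoTorsion W) (hd : DescAdmissible W d)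
    (hχ : IsQuadraticCharacterOf χ d) (w : InfinitePlace ℚ) :
    ((∀ c ∈ W.selmerGroup ((2 : ℕ) : ℤ), galoisCohomology.localization (W.torsionGaloisModule ((2 : ℕ) : ℤ)) (Sum.inl w) 1 c = 0) ∧
        PrimeTwist.selmerGroup W χ = selmerGroupRelaxedAtInfinityAtTwo W) ∨
      ((∃ c ∈ W.selmerGroup ((2 : ℕ) : ℤ), galoisCohomology.localization (W.torsionGaloisModule ((2 : ℕ) : ℤ)) (Sum.inl w) 1 c ≠ 0) ∧
        PrimeTwist.selmerGroup W χ = (kummerStrict W 2 {(Sum.inl w : Place ℚ)}).selmerGroup) := by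
  by_cases hall : ∀ c ∈ W.selmerGroup ((2 : ℕ) : ℤ), galoisCohomology.localization (W.torsionGaloisModule ((2 : ℕ) : ℤ)) (Sum.inl w) 1 c = 0
  · exact Or.inl ⟨hall, (primeTwist_selmerGroup_eq_relaxed_of_forall_localization_eq_zero W hΔ hT hd hχ w hall).1⟩
  · push Not at hall
    exact Or.inr ⟨hall, primeTwist_selmerGroup_eq_kummerStrict_of_exists_localization_ne_zero W hΔ hd hχ w hall⟩

/-- **RIGIDITY — Theorem A(i) in prime-twist currency: `Sel_𝔓(A_{χ_d}/ℚ) = Sel_𝔓(A_{χ_{d'}}/ℚ)` inside `H¹(ℚ, E[2])` for all descent-admissible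
`d, d'`** (`Δ_W > 0`, `E(ℚ)[2] = 0`; both equal `Sel₂^{rel ∞}(W)` or both `Sel₂^{str ∞}(W)`, according to the `∞`-bit of `Sel₂(W)` alone). T-A′
`AdmissibleTwistSelmerLevelAtTwo` as an equality of groups. [cite: Morgan2023KummerGeneric, Lemma 16] [cite: Kramer1981, Thm. 1] [cite: MazurRubin2010, Prop 3.3] -/
theorem primeTwist_selmerGroup_eq_of_descAdmissible (hΔ : 0 < W.Δ) (hT : NoRationalTwoTorsion W) (hd : DescAdmissible W d)
    (hχ : IsQuadraticCharacterOf χ d) (hd' : DescAdmissible W d') (hχ' : IsQuadraticCharacterOf χ' d') :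
    PrimeTwist.selmerGroup W χ = PrimeTwist.selmerGroup W χ' := by
  rcases primeTwist_selmerGroup_eq_relaxed_or_eq_kummerStrict_decided W hΔ hT hd hχ Rat.infinitePlace with ⟨hall, h⟩ | ⟨hex, h⟩
  · rw [h, (primeTwist_selmerGroup_eq_relaxed_of_forall_localization_eq_zero W hΔ hT hd' hχ' Rat.infinitePlace hall).1]
  · rw [h, primeTwist_selmerGroup_eq_kummerStrict_of_exists_localization_ne_zero W hΔ hd' hχ' Rat.infinitePlace hex]

/-- **… and the counts agree: `#Sel_𝔓(A_{χ_d}) = #Sel_𝔓(A_{χ_{d'}})`.** [cite: Kramer1981, Prop. 6] -/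
theorem natCard_primeTwist_selmerGroup_eq_of_descAdmissible (hΔ : 0 < W.Δ) (hT : NoRationalTwoTorsion W) (hd : DescAdmissible W d)
    (hχ : IsQuadraticCharacterOf χ d) (hd' : DescAdmissible W d') (hχ' : IsQuadraticCharacterOf χ' d') :
    Nat.card (PrimeTwist.selmerGroup W χ) = Nat.card (PrimeTwist.selmerGroup W χ') := by
  rw [primeTwist_selmerGroup_eq_of_descAdmissible W hΔ hT hd hχ hd' hχ']

/-! ## §184 The odd branch: the canonical `d`-free `R` -/

/-- **On the odd branch `Sel_𝔓(A_χ/ℚ) = Sel₂^{rel ∞}(W)` for EVERY descent-admissible `d`** (the canonical, `d`-free `R` of the `-desc` memo §17.9;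
`#Sel_𝔓 = #Sel₂(W^{(d)}) = 8 = 2·4` and DESC-§17-R). [cite: MazurRubin2010, Lemma 3.2 and Prop 3.3] [cite: MazurRubin2007, §3 and Def 4.3] -/
theorem primeTwist_selmerGroup_eq_relaxed_of_onOddBranch (hodd : OnOddBranchAtTwo W) (hd : DescAdmissible W d) (hχ : IsQuadraticCharacterOf χ d) :
    PrimeTwist.selmerGroup W χ = selmerGroupRelaxedAtInfinityAtTwo W := by
  obtain ⟨_, _, _, hS4, htw⟩ := hodd
  refine (twistSelmerEqRelaxedAtInfinityAtTwo_holds W d χ hd hχ).2 ?_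
  rw [natCard_primeTwist_selmerGroup_eq_twistSelmerTwoCard W hd.1.ne hχ, htw d hd, hS4]

/-- **On the odd branch `#Sel₂^{rel ∞}(W) = 8`** as soon as ONE descent-admissible `d` with a character exists (it does: Chebotarev / `quadraticCharacterExists_holds`;
here displayed). [cite: MazurRubin2010, Lemma 3.2] -/
theorem natCard_selmerGroupRelaxedAtInfinityAtTwo_eq_eight_of_onOddBranch (hodd : OnOddBranchAtTwo W) (hd : DescAdmissible W d)
    (hχ : IsQuadraticCharacterOf χ d) : Nat.card (selmerGroupRelaxedAtInfinityAtTwo W) = 8 := by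
  rw [← primeTwist_selmerGroup_eq_relaxed_of_onOddBranch W hodd hd hχ, natCard_primeTwist_selmerGroup_eq_twistSelmerTwoCard W hd.1.ne hχ]
  exact hodd.2.2.2.2 d hd

/-- **On the odd branch `[Sel₂^{rel ∞}(W) : Sel₂(W)] = 2`** (given one admissible `d` with a character). [cite: MazurRubin2010, Lemma 3.2] -/
theorem relIndex_selmerGroup_relaxed_eq_two_of_onOddBranch (hodd : OnOddBranchAtTwo W) (hd : DescAdmissible W d)
    (hχ : IsQuadraticCharacterOf χ d) : (W.selmerGroup ((2 : ℕ) : ℤ)).relIndex (selmerGroupRelaxedAtInfinityAtTwo W) = 2 := by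
  have h := natCard_selmerGroupRelaxedAtInfinityAtTwo_eq_mul W
  rw [natCard_selmerGroupRelaxedAtInfinityAtTwo_eq_eight_of_onOddBranch W hodd hd hχ, hodd.2.2.2.1] at h
  omega

/-- **On the odd branch every `Sel₂(W) = Ш(W)[2]`-class is trivial at `∞`** (index `2` ⟺ strict, file 17), given one admissible `d` with a character.
[cite: MazurRubin2010, Lemma 3.2] [cite: Kramer1981, Prop. 7] -/
theorem forall_localization_eq_zero_of_onOddBranch (hodd : OnOddBranchAtTwo W) (hd : DescAdmissible W d) (hχ : IsQuadraticCharacterOf χ d)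
    (w : InfinitePlace ℚ) :
    ∀ c ∈ W.selmerGroup ((2 : ℕ) : ℤ), galoisCohomology.localization (W.torsionGaloisModule ((2 : ℕ) : ℤ)) (Sum.inl w) 1 c = 0 :=
  (relIndex_selmerGroup_selmerGroupRelaxedAtInfinityAtTwo_eq_two_iff_of_Δ_pos W hodd.1 w).mp
    (relIndex_selmerGroup_relaxed_eq_two_of_onOddBranch W hodd hd hχ)

/-- **On the odd branch `Sel₂(W) = Sel₂^{str ∞}(W) = {r ∈ R : res_∞ r = 0}`** (given one admissible `d` with a character): the `-desc` memo's
`S = {x ∈ R : res_∞ x = 0}`. [cite: MazurRubin2010, Lemma 3.2] [cite: Kramer1981, Prop. 7] -/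
theorem selmerGroup_eq_kummerStrict_of_onOddBranch (hodd : OnOddBranchAtTwo W) (hd : DescAdmissible W d) (hχ : IsQuadraticCharacterOf χ d)
    (w : InfinitePlace ℚ) :
    W.selmerGroup ((2 : ℕ) : ℤ) = (kummerStrict W 2 {(Sum.inl w : Place ℚ)}).selmerGroup :=
  selmerGroup_eq_selmerGroup_kummerStrict_of_forall_localization_eq_zero W w (forall_localization_eq_zero_of_onOddBranch W hodd hd hχ w)


/-! ## §185 APPEND (g15): U′'s conclusion off the odd branch — decided by the Selmer egg bit alone -/

/-- **U′ OFF THE ODD BRANCH, DECIDED.** For `Δ_W > 0`, `E(ℚ)[2] = 0`, `d` descent-admissible with character `χ`: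
«`Sel₂(W) ≤ Sel_𝔓(A_χ/ℚ)` with index `2`» holds IFF every `Sel₂(W)`-class is trivial at `∞` (Selmer egg bit `0`). File 38's
`selmerGroup_le_and_relIndex_eq_two_iff` reduced the left side to «egg bit `0` ∧ UP»; file 40's UP decision (§180) removes the second conjunct.
[cite: Kramer1981, Thm. 1 and Prop. 7] [cite: MazurRubin2010, Lemma 3.2 and Prop 3.3] -/
theorem selmerGroup_le_and_relIndex_eq_two_iff_forall_localization_eq_zero (hΔ : 0 < W.Δ) (hT : NoRationalTwoTorsion W)
    (hd : DescAdmissible W d) (hχ : IsQuadraticCharacterOf χ d) (w : InfinitePlace ℚ) :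
    (W.selmerGroup ((2 : ℕ) : ℤ) ≤ PrimeTwist.selmerGroup W χ ∧ (W.selmerGroup ((2 : ℕ) : ℤ)).relIndex (PrimeTwist.selmerGroup W χ) = 2) ↔
      ∀ c ∈ W.selmerGroup ((2 : ℕ) : ℤ), galoisCohomology.localization (W.torsionGaloisModule ((2 : ℕ) : ℤ)) (Sum.inl w) 1 c = 0 := by
  rw [selmerGroup_le_and_relIndex_eq_two_iff W hΔ hd hχ w]
  exact ⟨fun h ↦ h.1, fun hall ↦ ⟨hall, (primeTwist_selmerGroup_eq_relaxed_of_forall_localization_eq_zero W hΔ hT hd hχ w hall).1⟩⟩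

/-- **… and its failure is DOWN**: if some `Sel₂(W)`-class is non-trivial at `∞` then `Sel_𝔓(A_χ/ℚ) ≤ Sel₂(W)` with index `2` (the roles swap:
`Sel_𝔓 = Sel₂^{str ∞} ≤ Sel₂ = Sel₂^{rel ∞}`). [cite: Kramer1981, Thm. 1 and Prop. 7] [cite: MazurRubin2010, Lemma 3.2 and Prop 3.3] -/
theorem primeTwist_selmerGroup_le_and_relIndex_eq_two_of_exists_localization_ne_zero (hΔ : 0 < W.Δ) (hd : DescAdmissible W d)
    (hχ : IsQuadraticCharacterOf χ d) (w : InfinitePlace ℚ)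
    (hex : ∃ c ∈ W.selmerGroup ((2 : ℕ) : ℤ), galoisCohomology.localization (W.torsionGaloisModule ((2 : ℕ) : ℤ)) (Sum.inl w) 1 c ≠ 0) :
    PrimeTwist.selmerGroup W χ ≤ W.selmerGroup ((2 : ℕ) : ℤ) ∧ (PrimeTwist.selmerGroup W χ).relIndex (W.selmerGroup ((2 : ℕ) : ℤ)) = 2 := by
  have hP := primeTwist_selmerGroup_eq_kummerStrict_of_exists_localization_ne_zero W hΔ hd hχ w hex
  have hS : W.selmerGroup ((2 : ℕ) : ℤ) = selmerGroupRelaxedAtInfinityAtTwo W := by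
    rcases selmerGroup_eq_kummerStrict_or_eq_relaxed_of_Δ_pos W hΔ w with h | h
    · exfalso
      obtain ⟨c, hc, hne⟩ := hex
      rw [h] at hc
      exact hne ((mem_selmerGroup_kummerStrict_singleton_inl_iff W w c).mp hc).2
    · exact h
  rw [hP, hS]
  exact ⟨selmerGroup_kummerStrict_singleton_inl_le_selmerGroup W w |>.trans (selmerGroup_le_selmerGroupRelaxedAtInfinityAtTwo W),
    relIndex_kummerStrict_selmerGroupRelaxedAtInfinityAtTwo_eq_two_of_Δ_pos W hΔ w⟩

end Summit.BirchSwinnertonDyer.BirchSwinnertonDyer.Theorems.GenusKolyArch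

end
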